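import Mathlib
import HarnessLib
import Literature.Combinatorics.SimpleGraph.LasserreStableBound
import Summits.PneNP.PneNP.Theses.RamseyUncertifiable
import Summits.PneNP.PneNP.Theorems.RamseyUncertifiableSosUncertaintyGraphOperations
import Summits.PneNP.PneNP.Theorems.RamseyUncertifiableSosUncertaintyJoinQuadForm

/-!
# Route `RamseyUncertifiable`, item `SosUncertainty` (stmt-PneNP-9815) — Lasserre's bound of a join
# is the maximum of the parts, II: the theorem and the exact product of a disjoint union

* `lasserreStableBound_le_max_of_forall_adj` — for a JOIN `P` on `V ⊕ W` (every left vertex adjacent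
  to every right vertex), `las_t(P) ≤ max (las_t(P.comap inl)) (las_t(P.comap inr))` (`t ≥ 1`): the
  `p`-trick of `RamseyUncertifiableSosUncertaintyJoinQuadForm.lean` — with `p = sup ℓ_L²/q_L`,
  `p' = sup ℓ_R²/q_R` one has `p + p' ≤ 1`, the left singletons of a feasible `y` sum to
  `≤ p · las_t(left)` (scaled restriction) and the right ones to `≤ p' · las_t(right)`.
* `lasserreStableBound_compl_sum` — `las_t((G ⊕g H)ᶜ) = max (las_t Gᶜ) (las_t Hᶜ)` (with
  `lasserreStableBound_compl_le_compl_sum_left/right` of the GraphOperations file).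
* `uncertaintyProduct_sum_eq` — the EXACT uncertainty product of a disjoint union,
  `f_t(G ⊕g H) = (las_t G + las_t H) · max (las_t Gᶜ) (las_t Hᶜ)`; e.g. `f₂(m·C₅) = 4n/5`.
[folklore; `t = 1`: Lovász 1979 / Knuth 1994 §20]
-/

-- the Theorems namespace `Summit.PneNP.PneNP.Theorems` is prescribed by the tree layout
set_option linter.dupNamespace false

namespace Summit.PneNP.PneNP.Theorems.SosUncertainty

open Literature.Combinatorics.SimpleGraph Finset Matrix

variable {V W : Type} [Fintype V] [DecidableEq V] [Fintype W] [DecidableEq W]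

/-- **Lasserre's bound of a join is at most the maximum of the parts** (`t ≥ 1`). -/
theorem lasserreStableBound_le_max_of_forall_adj {P : SimpleGraph (V ⊕ W)}
    (hP : ∀ v w, P.Adj (Sum.inl v) (Sum.inr w)) {t : ℕ} (ht : 1 ≤ t) :
    lasserreStableBound P t ≤
      max (lasserreStableBound (P.comap (Function.Embedding.inl : V ↪ V ⊕ W)) t)
        (lasserreStableBound (P.comap (Function.Embedding.inr : W ↪ V ⊕ W)) t) := by
  refine lasserreStableBound_le_of_forall fun y hy => ?_
  set L₁ := lasserreStableBound (P.comap (Function.Embedding.inl : V ↪ V ⊕ W)) t with hL₁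
  set L₂ := lasserreStableBound (P.comap (Function.Embedding.inr : W ↪ V ⊕ W)) t with hL₂
  have hL₁0 : 0 ≤ L₁ := lasserreStableBound_nonneg _ t ht
  have hL₂0 : 0 ≤ L₂ := lasserreStableBound_nonneg _ t ht
  -- the ratio sets and their suprema
  set RL : Set ℝ := insert 0 {r | ∃ z : {S : Finset V // S ≠ ∅ ∧ S.card ≤ t} → ℝ, 0 < ∑ S, ∑ S', z S * y ((S.1 ∪ S'.1).map Function.Embedding.inl) * z S' ∧ r = (∑ S, z S * y (S.1.map Function.Embedding.inl)) ^ 2 / ∑ S, ∑ S', z S * y ((S.1 ∪ S'.1).map Function.Embedding.inl) * z S'} with hRL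
  set RR : Set ℝ := insert 0 {r | ∃ z : {T : Finset W // T ≠ ∅ ∧ T.card ≤ t} → ℝ, 0 < ∑ T, ∑ T', z T * y ((T.1 ∪ T'.1).map Function.Embedding.inr) * z T' ∧ r = (∑ T, z T * y (T.1.map Function.Embedding.inr)) ^ 2 / ∑ T, ∑ T', z T * y ((T.1 ∪ T'.1).map Function.Embedding.inr) * z T'} with hRR
  have hRL1 : ∀ r ∈ RL, r ≤ 1 := by
    rintro r (rfl | ⟨z, hq, rfl⟩)
    · norm_num
    · rw [div_le_one hq]; exact lin_sq_le_quad_left hP hy z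
  have hRR1 : ∀ r ∈ RR, r ≤ 1 := by
    rintro r (rfl | ⟨z, hq, rfl⟩)
    · norm_num
    · rw [div_le_one hq]; exact lin_sq_le_quad_right hP hy z
  have hbL : BddAbove RL := ⟨1, hRL1⟩
  have hbR : BddAbove RR := ⟨1, hRR1⟩
  have hneL : RL.Nonempty := ⟨0, Set.mem_insert _ _⟩
  have hneR : RR.Nonempty := ⟨0, Set.mem_insert _ _⟩
  set p := sSup RL with hp
  set p' := sSup RR with hp'
  have hp0 : 0 ≤ p := le_csSup hbL (Set.mem_insert 0 _)
  have hp'0 : 0 ≤ p' := le_csSup hbR (Set.mem_insert 0 _)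
  -- domination on each side
  have hdomL : ∀ z : {S : Finset V // S ≠ ∅ ∧ S.card ≤ t} → ℝ, (∑ S, z S * y (S.1.map Function.Embedding.inl)) ^ 2 ≤ p * ∑ S, ∑ S', z S * y ((S.1 ∪ S'.1).map Function.Embedding.inl) * z S' := by
    intro z
    have hlq := lin_sq_le_quad_left hP hy z
    rcases lt_or_ge 0 (∑ S, ∑ S', z S * y ((S.1 ∪ S'.1).map Function.Embedding.inl) * z S') with hq | hq
    · have hr : (∑ S, z S * y (S.1.map Function.Embedding.inl)) ^ 2 / ∑ S, ∑ S', z S * y ((S.1 ∪ S'.1).map Function.Embedding.inl) * z S' ≤ p := le_csSup hbL (Set.mem_insert_of_mem _ ⟨z, hq, rfl⟩)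
      rwa [div_le_iff₀ hq] at hr
    · have h0 : ∑ S, ∑ S', z S * y ((S.1 ∪ S'.1).map Function.Embedding.inl) * z S' = 0 := le_antisymm hq ((sq_nonneg _).trans hlq)
      rw [h0, mul_zero]
      rw [h0] at hlq
      exact hlq
  have hdomR : ∀ z : {T : Finset W // T ≠ ∅ ∧ T.card ≤ t} → ℝ, (∑ T, z T * y (T.1.map Function.Embedding.inr)) ^ 2 ≤ p' * ∑ T, ∑ T', z T * y ((T.1 ∪ T'.1).map Function.Embedding.inr) * z T' := by
    intro z
    have hlq := lin_sq_le_quad_right hP hy z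
    rcases lt_or_ge 0 (∑ T, ∑ T', z T * y ((T.1 ∪ T'.1).map Function.Embedding.inr) * z T') with hq | hq
    · have hr : (∑ T, z T * y (T.1.map Function.Embedding.inr)) ^ 2 / ∑ T, ∑ T', z T * y ((T.1 ∪ T'.1).map Function.Embedding.inr) * z T' ≤ p' := le_csSup hbR (Set.mem_insert_of_mem _ ⟨z, hq, rfl⟩)
      rwa [div_le_iff₀ hq] at hr
    · have h0 : ∑ T, ∑ T', z T * y ((T.1 ∪ T'.1).map Function.Embedding.inr) * z T' = 0 := le_antisymm hq ((sq_nonneg _).trans hlq)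
      rw [h0, mul_zero]
      rw [h0] at hlq
      exact hlq
  -- `p + p' ≤ 1`
  have hpp : p + p' ≤ 1 := by
    have key : ∀ r ∈ RR, r ≤ 1 - p := by
      rintro r (rfl | ⟨z', hq', rfl⟩)
      · have := csSup_le hneL hRL1; linarith
      · have hle : p ≤ 1 - (∑ T, z' T * y (T.1.map Function.Embedding.inr)) ^ 2 / ∑ T, ∑ T', z' T * y ((T.1 ∪ T'.1).map Function.Embedding.inr) * z' T' := by
          refine csSup_le hneL ?_
          rintro r₁ (rfl | ⟨z, hq, rfl⟩)
          · have := hRR1 _ (Set.mem_insert_of_mem _ ⟨z', hq', rfl⟩); linarith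
          · have := ratio_add_ratio_le_one hq hq' (fun a b c => join_quadForm_nonneg_smul hP hy a b c z z')
            linarith
        linarith
    have := csSup_le hneR key
    linarith
  -- the left singletons
  have hleft : ∑ v, y {Sum.inl v} ≤ p * L₁ := by
    rcases hp0.eq_or_lt with hpz | hppos
    · have hz : ∀ v, y {Sum.inl v} = 0 := by
        intro v
        have h := hdomL (fun S => if S.1 = {v} then 1 else 0)
        have hl : (∑ S : {S : Finset V // S ≠ ∅ ∧ S.card ≤ t}, (fun S : {S : Finset V // S ≠ ∅ ∧ S.card ≤ t} => if S.1 = {v} then (1 : ℝ) else 0) S *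
            y (S.1.map Function.Embedding.inl)) = y {Sum.inl v} := by
          rw [Finset.sum_eq_single ⟨{v}, by simp, by rw [card_singleton]; exact ht⟩]
          · simp
          · intro b _ hb
            have : b.1 ≠ {v} := fun h => hb (Subtype.ext h)
            simp [this]
          · intro h; exact absurd (mem_univ _) h
        rw [hl, ← hpz, zero_mul] at h
        nlinarith [sq_nonneg (y {Sum.inl v})]
      simp [hz, ← hpz]
    · have hfeas := isLasserreFeasible_scaledRestrict_left hy hppos hdomL
      have h := hfeas.sum_singleton_le_lasserreStableBound ht
      have hsimp : ∀ v : V, (if ({v} : Finset V) = ∅ then (1 : ℝ) else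
          y (({v} : Finset V).map Function.Embedding.inl) / p) = y {Sum.inl v} / p := by
        intro v; rw [if_neg (singleton_ne_empty v), map_singleton]; rfl
      simp only [hsimp] at h
      rw [← Finset.sum_div, div_le_iff₀ hppos] at h
      linarith [mul_comm p L₁]
  -- the right singletons
  have hright : ∑ w, y {Sum.inr w} ≤ p' * L₂ := by
    rcases hp'0.eq_or_lt with hpz | hppos
    · have hz : ∀ w, y {Sum.inr w} = 0 := by
        intro w
        have h := hdomR (fun T => if T.1 = {w} then 1 else 0)
        have hl : (∑ T : {T : Finset W // T ≠ ∅ ∧ T.card ≤ t}, (fun T : {T : Finset W // T ≠ ∅ ∧ T.card ≤ t} => if T.1 = {w} then (1 : ℝ) else 0) T *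
            y (T.1.map Function.Embedding.inr)) = y {Sum.inr w} := by
          rw [Finset.sum_eq_single ⟨{w}, by simp, by rw [card_singleton]; exact ht⟩]
          · simp
          · intro b _ hb
            have : b.1 ≠ {w} := fun h => hb (Subtype.ext h)
            simp [this]
          · intro h; exact absurd (mem_univ _) h
        rw [hl, ← hpz, zero_mul] at h
        nlinarith [sq_nonneg (y {Sum.inr w})]
      simp [hz, ← hpz]
    · have hfeas := isLasserreFeasible_scaledRestrict_right hy hppos hdomR
      have h := hfeas.sum_singleton_le_lasserreStableBound ht
      have hsimp : ∀ w : W, (if ({w} : Finset W) = ∅ then (1 : ℝ) else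
          y (({w} : Finset W).map Function.Embedding.inr) / p') = y {Sum.inr w} / p' := by
        intro w; rw [if_neg (singleton_ne_empty w), map_singleton]; rfl
      simp only [hsimp] at h
      rw [← Finset.sum_div, div_le_iff₀ hppos] at h
      linarith [mul_comm p' L₂]
  -- assemble
  have hmax0 : 0 ≤ max L₁ L₂ := le_max_of_le_left hL₁0
  calc ∑ x, y {x} = ∑ v, y {Sum.inl v} + ∑ w, y {Sum.inr w} := Fintype.sum_sum_type _
    _ ≤ p * L₁ + p' * L₂ := add_le_add hleft hright
    _ ≤ p * max L₁ L₂ + p' * max L₁ L₂ :=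
        add_le_add (mul_le_mul_of_nonneg_left (le_max_left _ _) hp0)
          (mul_le_mul_of_nonneg_left (le_max_right _ _) hp'0)
    _ = (p + p') * max L₁ L₂ := by ring
    _ ≤ 1 * max L₁ L₂ := mul_le_mul_of_nonneg_right hpp hmax0
    _ = max L₁ L₂ := one_mul _

/-- **`las_t` of a join is the maximum of the parts**: `las_t((G ⊕g H)ᶜ) = max (las_t Gᶜ) (las_t Hᶜ)`
(`t ≥ 1`; `(G ⊕g H)ᶜ` is the join of `Gᶜ` and `Hᶜ`). -/
theorem lasserreStableBound_compl_sum (G : SimpleGraph V) (H : SimpleGraph W) {t : ℕ} (ht : 1 ≤ t) :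
    lasserreStableBound (G ⊕g H)ᶜ t = max (lasserreStableBound Gᶜ t) (lasserreStableBound Hᶜ t) := by
  refine le_antisymm ?_ (max_le (lasserreStableBound_compl_le_compl_sum_left G H ht)
    (lasserreStableBound_compl_le_compl_sum_right G H ht))
  have h := lasserreStableBound_le_max_of_forall_adj (P := (G ⊕g H)ᶜ)
    (fun v w => by simp [SimpleGraph.compl_adj]) ht
  rwa [comap_inl_compl_sum, comap_inr_compl_sum] at h

/-- **The exact uncertainty product of a disjoint union**:
`f_t(G ⊕g H) = (las_t G + las_t H) · max (las_t Gᶜ) (las_t Hᶜ)` (`t ≥ 1`). -/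
theorem uncertaintyProduct_sum_eq :
    ∀ {V W : Type} [Fintype V] [DecidableEq V] [Fintype W] [DecidableEq W]
      (G : SimpleGraph V) (H : SimpleGraph W) {t : ℕ}, 1 ≤ t →
      lasserreStableBound (G ⊕g H) t * lasserreStableBound (G ⊕g H)ᶜ t =
        (lasserreStableBound G t + lasserreStableBound H t) *
          max (lasserreStableBound Gᶜ t) (lasserreStableBound Hᶜ t) := by
  intro V W _ _ _ _ G H t ht
  rw [lasserreStableBound_sum G H ht, lasserreStableBound_compl_sum G H ht]

end Summit.PneNP.PneNP.Theorems.SosUncertainty
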